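import Mathlib
import Summits.Ventures.PercRepro2.TypedSeparatedSides
import Summits.Ventures.PercRepro2.TypedSpectator
import Summits.Ventures.PercRepro2.TypedUntouched

/-!
# The typed (SEP-3) zero, II: independent symmetrisation of the two sides of a separator (blind
cell PercRepro2, p3 g6, 2026-08-25; `proofs/P3-BRIDGE.md` §11.20)

A kernel that sees the typed edges of a side `A ⊆ F` through one group of arguments and those of a
disjoint side `B ⊆ F` through another (`sideKernel`) has the same typed count after the `A`-parts
of two copies are exchanged (`typedCount_mergeSwap12`, `typedCount_mergeSwap23`: the map
`(x, y) ↦ (mergeOn A y x, mergeOn A x y)` permutes the typed triples), and likewise for `B`.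
Hence the count is unchanged when the `A`-arguments and the `B`-arguments are permuted
INDEPENDENTLY, and `36 · typedCount (sideKernel Φ) = typedCount (sideKernel (symB (symA Φ)))`
(`thirtysix_mul_typedCount_side`).  Own work; standard axioms.
-/

namespace Summit.Ventures.PercRepro2

open UnionCluster

namespace CovForm

namespace SepThree

open OneTyped TypedA3 TypedFactor Separated Untouched

section Merge

variable {E : Type*} [DecidableEq E]

/-- The configuration that agrees with `a` on `A` and with `b` elsewhere. -/
def mergeOn (A : Finset E) (a b : Config E) : Config E := fun e => if e ∈ A then a e else b e

/-- On `A` the merge reads the first argument. -/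
lemma mergeOn_of_mem {A : Finset E} {a b : Config E} {e : E} (he : e ∈ A) :
    mergeOn A a b e = a e := by simp [mergeOn, he]

/-- Off `A` the merge reads the second argument. -/
lemma mergeOn_of_not_mem {A : Finset E} {a b : Config E} {e : E} (he : e ∉ A) :
    mergeOn A a b e = b e := by simp [mergeOn, he]

/-- Exchanging the `A`-parts twice is the identity. -/
lemma mergeOn_mergeOn (A : Finset E) (a b : Config E) :
    mergeOn A (mergeOn A a b) (mergeOn A b a) = a := by
  funext e
  by_cases he : e ∈ A
  · simp [mergeOn, he]
  · simp [mergeOn, he]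

/-- The restriction to `A` of an `A`-merge is the restriction of the first argument. -/
lemma restr_mergeOn_same (A : Finset E) (z a b : Config E) :
    restr A z (mergeOn A a b) = restr A z a := by
  funext e
  by_cases he : e ∈ A
  · rw [restr_of_mem he, restr_of_mem he, mergeOn_of_mem he]
  · rw [restr_of_not_mem he, restr_of_not_mem he]

/-- The restriction to a set disjoint from `A` of an `A`-merge is the restriction of the second
argument. -/
lemma restr_mergeOn_other {A B : Finset E} (hAB : Disjoint A B) (z a b : Config E) :
    restr B z (mergeOn A a b) = restr B z b := by
  funext e
  by_cases he : e ∈ B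
  · have hA : e ∉ A := Finset.disjoint_right.1 hAB he
    rw [restr_of_mem he, restr_of_mem he, mergeOn_of_not_mem hA]
  · rw [restr_of_not_mem he, restr_of_not_mem he]

/-- The `A`-exchange of a pair of configurations, as an equivalence. -/
def mergeSwap (A : Finset E) : Config E × Config E ≃ Config E × Config E where
  toFun p := (mergeOn A p.2 p.1, mergeOn A p.1 p.2)
  invFun p := (mergeOn A p.2 p.1, mergeOn A p.1 p.2)
  left_inv p := by
    obtain ⟨x, y⟩ := p
    simp only [mergeOn_mergeOn]
  right_inv p := by
    obtain ⟨x, y⟩ := p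
    simp only [mergeOn_mergeOn]

end Merge

section Swap

variable {E : Type*} [Fintype E] [DecidableEq E] {R : Type*} [Field R]

omit [Fintype E] in
/-- The typed-triple condition is invariant under exchanging the `A`-parts of the first two
copies (`A ⊆ F`). -/
lemma cond_mergeSwap12 {F : Finset E} {A : Finset E} (hA : A ⊆ F) (z : Config E) (τ : E → ℕ)
    (x y w : Config E) :
    ((∀ e, e ∉ F → mergeOn A y x e = z e ∧ mergeOn A x y e = z e ∧ w e = z e) ∧
        (∀ e ∈ F, openCount (mergeOn A y x) (mergeOn A x y) w e = τ e)) ↔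
      ((∀ e, e ∉ F → x e = z e ∧ y e = z e ∧ w e = z e) ∧ (∀ e ∈ F, openCount x y w e = τ e)) := by
  have h1 : ∀ e, e ∉ F → ((mergeOn A y x e = z e ∧ mergeOn A x y e = z e ∧ w e = z e) ↔
      (x e = z e ∧ y e = z e ∧ w e = z e)) := by
    intro e he
    have hA' : e ∉ A := fun h => he (hA h)
    rw [mergeOn_of_not_mem hA', mergeOn_of_not_mem hA']
  have h2 : ∀ e, openCount (mergeOn A y x) (mergeOn A x y) w e = openCount x y w e := by
    intro e
    by_cases he : e ∈ A
    · simp only [openCount, mergeOn_of_mem he]; ring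
    · simp only [openCount, mergeOn_of_not_mem he]
  constructor
  · rintro ⟨c1, c2⟩
    exact ⟨fun e he => (h1 e he).1 (c1 e he), fun e he => by rw [← h2 e]; exact c2 e he⟩
  · rintro ⟨c1, c2⟩
    exact ⟨fun e he => (h1 e he).2 (c1 e he), fun e he => by rw [h2 e]; exact c2 e he⟩

omit [Fintype E] in
/-- The typed-triple condition is invariant under exchanging the `A`-parts of the last two
copies (`A ⊆ F`). -/
lemma cond_mergeSwap23 {F : Finset E} {A : Finset E} (hA : A ⊆ F) (z : Config E) (τ : E → ℕ)
    (x y w : Config E) :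
    ((∀ e, e ∉ F → x e = z e ∧ mergeOn A w y e = z e ∧ mergeOn A y w e = z e) ∧
        (∀ e ∈ F, openCount x (mergeOn A w y) (mergeOn A y w) e = τ e)) ↔
      ((∀ e, e ∉ F → x e = z e ∧ y e = z e ∧ w e = z e) ∧ (∀ e ∈ F, openCount x y w e = τ e)) := by
  have h1 : ∀ e, e ∉ F → ((x e = z e ∧ mergeOn A w y e = z e ∧ mergeOn A y w e = z e) ↔
      (x e = z e ∧ y e = z e ∧ w e = z e)) := by
    intro e he
    have hA' : e ∉ A := fun h => he (hA h)
    rw [mergeOn_of_not_mem hA', mergeOn_of_not_mem hA']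
  have h2 : ∀ e, openCount x (mergeOn A w y) (mergeOn A y w) e = openCount x y w e := by
    intro e
    by_cases he : e ∈ A
    · simp only [openCount, mergeOn_of_mem he]; ring
    · simp only [openCount, mergeOn_of_not_mem he]
  constructor
  · rintro ⟨c1, c2⟩
    exact ⟨fun e he => (h1 e he).1 (c1 e he), fun e he => by rw [← h2 e]; exact c2 e he⟩
  · rintro ⟨c1, c2⟩
    exact ⟨fun e he => (h1 e he).2 (c1 e he), fun e he => by rw [h2 e]; exact c2 e he⟩

/-- A double sum is unchanged by the `A`-exchange of its two summation variables. -/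
lemma sum_mergeSwap (A : Finset E) (g : Config E → Config E → R) :
    (∑ x : Config E, ∑ y : Config E, g (mergeOn A y x) (mergeOn A x y)) =
      ∑ x : Config E, ∑ y : Config E, g x y := by
  rw [← Fintype.sum_prod_type' (fun x y => g (mergeOn A y x) (mergeOn A x y)),
    ← Fintype.sum_prod_type' g]
  exact Equiv.sum_comp (mergeSwap A) (fun p : Config E × Config E => g p.1 p.2)

/-- **Exchanging the `A`-parts of the first two copies preserves the typed count.** -/
theorem typedCount_mergeSwap12 (F : Finset E) {A : Finset E} (hA : A ⊆ F) (z : Config E)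
    (τ : E → ℕ) (K : Config E → Config E → Config E → R) :
    typedCount F z τ (fun x y w => K (mergeOn A y x) (mergeOn A x y) w) = typedCount F z τ K := by
  unfold typedCount
  have key : ∀ x y : Config E,
      (∑ w : Config E, if (∀ e, e ∉ F → x e = z e ∧ y e = z e ∧ w e = z e) ∧
          (∀ e ∈ F, openCount x y w e = τ e) then K (mergeOn A y x) (mergeOn A x y) w else 0) =
      (fun x' y' => ∑ w : Config E, if (∀ e, e ∉ F → x' e = z e ∧ y' e = z e ∧ w e = z e) ∧
          (∀ e ∈ F, openCount x' y' w e = τ e) then K x' y' w else 0)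
        (mergeOn A y x) (mergeOn A x y) := by
    intro x y
    refine Finset.sum_congr rfl fun w _ => ?_
    exact (if_congr (cond_mergeSwap12 hA z τ x y w) rfl rfl).symm
  simp only [key]
  exact sum_mergeSwap A (fun x' y' => ∑ w : Config E,
    if (∀ e, e ∉ F → x' e = z e ∧ y' e = z e ∧ w e = z e) ∧ (∀ e ∈ F, openCount x' y' w e = τ e)
      then K x' y' w else 0)

/-- **Exchanging the `A`-parts of the last two copies preserves the typed count.** -/
theorem typedCount_mergeSwap23 (F : Finset E) {A : Finset E} (hA : A ⊆ F) (z : Config E)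
    (τ : E → ℕ) (K : Config E → Config E → Config E → R) :
    typedCount F z τ (fun x y w => K x (mergeOn A w y) (mergeOn A y w)) = typedCount F z τ K := by
  unfold typedCount
  refine Finset.sum_congr rfl fun x _ => ?_
  have key : ∀ y w : Config E,
      (if (∀ e, e ∉ F → x e = z e ∧ y e = z e ∧ w e = z e) ∧
          (∀ e ∈ F, openCount x y w e = τ e) then K x (mergeOn A w y) (mergeOn A y w) else 0) =
      (fun y' w' => if (∀ e, e ∉ F → x e = z e ∧ y' e = z e ∧ w' e = z e) ∧
          (∀ e ∈ F, openCount x y' w' e = τ e) then K x y' w' else 0)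
        (mergeOn A w y) (mergeOn A y w) := by
    intro y w
    exact (if_congr (cond_mergeSwap23 hA z τ x y w) rfl rfl).symm
  simp only [key]
  exact sum_mergeSwap A (fun y' w' =>
    if (∀ e, e ∉ F → x e = z e ∧ y' e = z e ∧ w' e = z e) ∧ (∀ e ∈ F, openCount x y' w' e = τ e)
      then K x y' w' else 0)

end Swap

section Side

variable {E : Type*} [Fintype E] [DecidableEq E] {R : Type*} [Field R]

/-- A kernel that sees the side `A` through its first three arguments and the side `B` through
the last three. -/
def sideKernel (A B : Finset E) (z : Config E)
    (Φ : Config E → Config E → Config E → Config E → Config E → Config E → R) :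
    Config E → Config E → Config E → R :=
  fun x y w => Φ (restr A z x) (restr A z y) (restr A z w) (restr B z x) (restr B z y) (restr B z w)

variable (F : Finset E) {A B : Finset E} (hA : A ⊆ F) (hB : B ⊆ F) (hAB : Disjoint A B)
  (z : Config E) (τ : E → ℕ)
  (Φ : Config E → Config E → Config E → Config E → Config E → Config E → R)

include hA hAB in
/-- The `A`-arguments of the first two copies may be exchanged. -/
lemma sideKernel_A12 :
    typedCount F z τ (sideKernel A B z fun xa ya wa xb yb wb => Φ ya xa wa xb yb wb) =
      typedCount F z τ (sideKernel A B z Φ) := by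
  rw [← typedCount_mergeSwap12 F hA z τ (sideKernel A B z Φ)]
  congr 1
  funext x y w
  simp only [sideKernel, restr_mergeOn_same, restr_mergeOn_other hAB]

include hA hAB in
/-- The `A`-arguments of the last two copies may be exchanged. -/
lemma sideKernel_A23 :
    typedCount F z τ (sideKernel A B z fun xa ya wa xb yb wb => Φ xa wa ya xb yb wb) =
      typedCount F z τ (sideKernel A B z Φ) := by
  rw [← typedCount_mergeSwap23 F hA z τ (sideKernel A B z Φ)]
  congr 1
  funext x y w
  simp only [sideKernel, restr_mergeOn_same, restr_mergeOn_other hAB]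

include hB hAB in
/-- The `B`-arguments of the first two copies may be exchanged. -/
lemma sideKernel_B12 :
    typedCount F z τ (sideKernel A B z fun xa ya wa xb yb wb => Φ xa ya wa yb xb wb) =
      typedCount F z τ (sideKernel A B z Φ) := by
  rw [← typedCount_mergeSwap12 F hB z τ (sideKernel A B z Φ)]
  congr 1
  funext x y w
  simp only [sideKernel, restr_mergeOn_same, restr_mergeOn_other hAB.symm]

include hB hAB in
/-- The `B`-arguments of the last two copies may be exchanged. -/
lemma sideKernel_B23 :
    typedCount F z τ (sideKernel A B z fun xa ya wa xb yb wb => Φ xa ya wa xb wb yb) =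
      typedCount F z τ (sideKernel A B z Φ) := by
  rw [← typedCount_mergeSwap23 F hB z τ (sideKernel A B z Φ)]
  congr 1
  funext x y w
  simp only [sideKernel, restr_mergeOn_same, restr_mergeOn_other hAB.symm]

/-- The six-fold symmetrisation over the `A`-arguments. -/
def symA (Φ : Config E → Config E → Config E → Config E → Config E → Config E → R) :
    Config E → Config E → Config E → Config E → Config E → Config E → R :=
  fun xa ya wa xb yb wb => Φ xa ya wa xb yb wb + Φ xa wa ya xb yb wb + Φ ya xa wa xb yb wb +
    Φ ya wa xa xb yb wb + Φ wa xa ya xb yb wb + Φ wa ya xa xb yb wb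

/-- The six-fold symmetrisation over the `B`-arguments. -/
def symB (Φ : Config E → Config E → Config E → Config E → Config E → Config E → R) :
    Config E → Config E → Config E → Config E → Config E → Config E → R :=
  fun xa ya wa xb yb wb => Φ xa ya wa xb yb wb + Φ xa ya wa xb wb yb + Φ xa ya wa yb xb wb +
    Φ xa ya wa yb wb xb + Φ xa ya wa wb xb yb + Φ xa ya wa wb yb xb

omit [Fintype E] in
/-- The side kernel of a sum is the sum of the side kernels. -/
lemma sideKernel_add (Φ Ψ : Config E → Config E → Config E → Config E → Config E → Config E → R) :
    sideKernel A B z (fun xa ya wa xb yb wb => Φ xa ya wa xb yb wb + Ψ xa ya wa xb yb wb) =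
      fun x y w => sideKernel A B z Φ x y w + sideKernel A B z Ψ x y w := rfl

include hA hAB in
/-- **Six times the count of a side kernel is the count of its `A`-symmetrisation.** -/
theorem six_mul_typedCount_sideA :
    6 * typedCount F z τ (sideKernel A B z Φ) = typedCount F z τ (sideKernel A B z (symA Φ)) := by
  unfold symA
  rw [sideKernel_add, typedCount_add', sideKernel_add, typedCount_add', sideKernel_add,
    typedCount_add', sideKernel_add, typedCount_add', sideKernel_add, typedCount_add']
  have t2 := sideKernel_A23 F hA hAB z τ Φ
  have t3 := sideKernel_A12 F hA hAB z τ Φ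
  have t4 := (sideKernel_A12 F hA hAB z τ (fun xa ya wa xb yb wb => Φ xa wa ya xb yb wb)).trans t2
  have t5 := (sideKernel_A23 F hA hAB z τ (fun xa ya wa xb yb wb => Φ ya xa wa xb yb wb)).trans t3
  have t6 := (sideKernel_A12 F hA hAB z τ (fun xa ya wa xb yb wb => Φ wa xa ya xb yb wb)).trans t5
  rw [t2, t3, t4, t5, t6]
  ring

include hB hAB in
/-- **Six times the count of a side kernel is the count of its `B`-symmetrisation.** -/
theorem six_mul_typedCount_sideB :
    6 * typedCount F z τ (sideKernel A B z Φ) = typedCount F z τ (sideKernel A B z (symB Φ)) := by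
  unfold symB
  rw [sideKernel_add, typedCount_add', sideKernel_add, typedCount_add', sideKernel_add,
    typedCount_add', sideKernel_add, typedCount_add', sideKernel_add, typedCount_add']
  have t2 := sideKernel_B23 F hB hAB z τ Φ
  have t3 := sideKernel_B12 F hB hAB z τ Φ
  have t4 := (sideKernel_B12 F hB hAB z τ (fun xa ya wa xb yb wb => Φ xa ya wa xb wb yb)).trans t2
  have t5 := (sideKernel_B23 F hB hAB z τ (fun xa ya wa xb yb wb => Φ xa ya wa yb xb wb)).trans t3
  have t6 := (sideKernel_B12 F hB hAB z τ (fun xa ya wa xb yb wb => Φ xa ya wa wb xb yb)).trans t5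
  rw [t2, t3, t4, t5, t6]
  ring

include hA hB hAB in
/-- **Thirty-six times the count of a side kernel is the count of its doubly symmetrised
form.** -/
theorem thirtysix_mul_typedCount_side :
    36 * typedCount F z τ (sideKernel A B z Φ) =
      typedCount F z τ (sideKernel A B z (symB (symA Φ))) := by
  rw [← six_mul_typedCount_sideB F hB hAB z τ (symA Φ), ← six_mul_typedCount_sideA F hA hAB z τ Φ]
  ring

end Side

section Zero

variable {E : Type*} [Fintype E] [DecidableEq E] {R : Type*} [Field R] [LinearOrder R]
  [IsStrictOrderedRing R]

/-- **A side kernel whose doubly symmetrised form vanishes has typed count zero.** -/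
theorem typedCount_side_eq_zero (F : Finset E) {A B : Finset E} (hA : A ⊆ F) (hB : B ⊆ F)
    (hAB : Disjoint A B) (z : Config E) (τ : E → ℕ)
    (Φ : Config E → Config E → Config E → Config E → Config E → Config E → R)
    (h : ∀ xa ya wa xb yb wb, symB (symA Φ) xa ya wa xb yb wb = 0) :
    typedCount F z τ (sideKernel A B z Φ) = 0 := by
  have h36 := thirtysix_mul_typedCount_side F hA hB hAB z τ Φ
  have hz : typedCount F z τ (sideKernel A B z (symB (symA Φ))) = 0 := by
    have : sideKernel A B z (symB (symA Φ)) = fun _ _ _ => (0 : R) := by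
      funext x y w
      exact h _ _ _ _ _ _
    rw [this]
    exact typedCount_zero_kernel F z τ
  rw [hz] at h36
  have h36' : (36 : R) ≠ 0 := by norm_num
  exact (mul_eq_zero.1 h36).resolve_left h36'

end Zero

end SepThree

end CovForm

end Summit.Ventures.PercRepro2
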